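import Summits.QuantumFields.YangMills.Theorems.BalabanUVNodesN21AveragingLower
import Literature.MathematicalPhysics.QuantumFieldTheory.Balaban1983to89.B8CurlGradHolonomy

/-!
# YM-DAG node N21 (= NE7c) — the oscillation input of `BalabanUVNodesN21AveragingLower` FROM A COVARIANT ONE-STEP
# BOUND: if consecutive plaquette variables differ covariantly by at most `γ` (`‖V(b)V(∂p′)V(b)⁻¹ − V(∂p)‖ ≤ γ`,
# `p′ = p + b`), the axial-gauge plaquette variables oscillate over the averaging stencil by at most
# `(2dL+4L)·(γ + 2(3dL+8L)·α₀²)`, so Prop. 1 two-sided holds with THAT `ω`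

Track A of `YM-PLAN.md` (cell `pub-ymgap`, HUMAN RULING D-0062), node **N21** of 28; seat `pub-ymgap-dag-n21-a`, generation 3,
file 4′ (companion of file 4 `BalabanUVNodesN21AveragingLower`).  `--supports stmt-QuantumFields-19182`.  Kernel bookkeeping,
imports file 4 only: 0 `def`, 0 `sorry`, standard axioms.  COUNT-NEUTRAL.

HONEST FRAMING.  NOT PRINTED in [Balaban1985Averaging] (which proves the upper bound (51) only and needs no regularity of the
configuration).  [folklore] lattice gauge calculus on the tree's objects: in the AXIAL GAUGE of p. 24 (`V₀ = V^{v₀}`,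
`v₀ = B7Prop1Explicit.axialFn V y`) one lattice step changes the plaquette variable `V₀(∂p)` by the COVARIANT forward difference
of `V(∂p)` (transport by the bond variable — the currency of the covariant gradient `∇_U F` of [Balaban1985Variational] Thm 1
(10), tree SHAPES `T4AveragingDeficitWall.covGrad`, `MinimalActionRefine.RegularSup.grad`) plus a conjugation defect
`≤ 2·|V₀(b) − 1|·|V(∂p) − 1| ≤ 2·|b₋ − y|₁·α₀²` (bond bound of p. 25, `axial_bond_bound`).  Summing along the tree contour between
two stencil plaquettes gives the hypothesis `ω` of `N21AveragingLower.prop1_twoSided`.  The passage flux → plaquette variable (one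
`exp`-Lipschitz step) and the junction with N16's record decl are file 5.  Nothing of Bałaban's is asserted.  One lattice `ℤ^d`;
NOT NE7c, NOT continuum ∕ OS ∕ mass gap ∕ Clay.

CITATION HEADER (lean-in-tree rule 2026-08-18).  Objects and estimates of `B7Prop1Explicit` BY NAME (`hol`, `plaqWord`,
`gaugeAct`, `axialFn`, `treeWord`, `boxVec`, `l1`, `U1`, `axial_bond_bound`, `norm_units_conj_sub_one_le`, `norm_inv_sub_one_le`),
`B8CurlGradHolonomy.norm_conj_le` and `N21AveragingLower.prop1_twoSided` ∕ `fine_lt_of_coarse_lt`; [Balaban1985Averaging] (T. Bałaban, *Averaging operations for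
lattice gauge theories*, Commun. Math. Phys. **98** (1985) 17–51, cell paper B7) is CONTEXT only — p. 24 (axial gauge
`V₀(Γ_{y,x}) = 1`) and p. 25 l. 3 (*"for `b ⊂ Δ(p′)` we have `|V₀,b − 1| < |b₋ − y|α₀`"*, as quoted in `B7Prop1Explicit`).

WHAT IS PROVED ([folklore]).  §1 `norm_inv_conj_sub_self_le` (`‖h⁻¹Qh − Q‖ ≤ 2‖h − 1‖‖Q − 1‖`, `h ∈ U1`).
§2 `axial_plaq_step`: one step `x ↦ x + e_κ` costs the covariant forward difference plus `2(|x − y|₁α₀)α₀`.  §3 `axial_plaq_path`: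
along a word of length `n` within `ℓ¹`-distance `R₁` of `y`: `≤ n(γ + 2R₁α₀α₀)`.  §4 `axial_plaq_osc_stencil`: between two stencil
plaquettes: `≤ (2dL+4L)(γ + 2(3dL+8L)α₀α₀)`.  §5 `prop1_twoSided_of_covariantStep` ∕ `fine_lt_of_coarse_lt_of_covariantStep`:
file 4's two-sided comparison ∕ threshold form from (44) + the covariant one-step bound ALONE.
-/

noncomputable section

open scoped BigOperators
open NormedSpace Finset

namespace Summit.QuantumFields.YangMills.Theorems.N21AveragingOscillation

open Literature.MathematicalPhysics.QuantumFieldTheory.Balaban1983to89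
open B7Prop1Explicit N21AveragingLower

variable {d : ℕ} {𝔸 : Type*} [NormedRing 𝔸] [NormOneClass 𝔸] [NormedAlgebra ℂ 𝔸] [CompleteSpace 𝔸]

/-! ## §1 Conjugation bookkeeping in `U1` -/

omit [NormedAlgebra ℂ 𝔸] [CompleteSpace 𝔸] in
/-- **Conjugation defect**: `‖h⁻¹Qh − Q‖ ≤ 2·‖h − 1‖·‖Q − 1‖` for `h ∈ U1` — from the identity
`h⁻¹Qh − Q = (h⁻¹ − 1)(Q − 1)h + (Q − 1)(h − 1)` and `‖h⁻¹ − 1‖ ≤ ‖h − 1‖`. [folklore] -/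
theorem norm_inv_conj_sub_self_le {h : 𝔸ˣ} (hh : h ∈ U1 𝔸) (Q : 𝔸) :
    ‖((h⁻¹ : 𝔸ˣ) : 𝔸) * Q * (h : 𝔸) - Q‖ ≤ 2 * ‖(h : 𝔸) - 1‖ * ‖Q - 1‖ := by
  have h1 : ((h⁻¹ : 𝔸ˣ) : 𝔸) * (h : 𝔸) = 1 := Units.inv_mul h
  have key : (((h⁻¹ : 𝔸ˣ) : 𝔸) - 1) * (Q - 1) * (h : 𝔸) + (Q - 1) * ((h : 𝔸) - 1)
      = ((h⁻¹ : 𝔸ˣ) : 𝔸) * Q * (h : 𝔸) - Q := by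
    calc _ = ((h⁻¹ : 𝔸ˣ) : 𝔸) * Q * (h : 𝔸) - ((h⁻¹ : 𝔸ˣ) : 𝔸) * (h : 𝔸) - Q + 1 := by noncomm_ring
      _ = _ := by rw [h1]; abel
  rw [← key]
  calc _ ≤ ‖(((h⁻¹ : 𝔸ˣ) : 𝔸) - 1) * (Q - 1) * (h : 𝔸)‖ + ‖(Q - 1) * ((h : 𝔸) - 1)‖ := norm_add_le _ _
    _ ≤ ‖((h⁻¹ : 𝔸ˣ) : 𝔸) - 1‖ * ‖Q - 1‖ * ‖(h : 𝔸)‖ + ‖Q - 1‖ * ‖(h : 𝔸) - 1‖ := by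
        gcongr
        · exact (norm_mul_le _ _).trans (mul_le_mul_of_nonneg_right (norm_mul_le _ _) (norm_nonneg _))
        · exact norm_mul_le _ _
    _ ≤ ‖(h : 𝔸) - 1‖ * ‖Q - 1‖ * 1 + ‖Q - 1‖ * ‖(h : 𝔸) - 1‖ := by
        gcongr
        · exact norm_inv_sub_one_le hh
        · exact hh.1
    _ = 2 * ‖(h : 𝔸) - 1‖ * ‖Q - 1‖ := by ring

/-! ## §2 One lattice step of the axial-gauge plaquette field -/

omit [NormedAlgebra ℂ 𝔸] [CompleteSpace 𝔸] in
/-- **ONE STEP in the axial gauge.**  `V` with values in `U1`, (44) with `α` for all unit plaquettes, `y` the base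
point of the axial gauge `V₀ = V^{v₀}` (`v₀ = axialFn V y`, p. 24).  Then for every site `x` and direction `κ` the
plaquette variables `V₀(∂p)` (`p` in the plane `μν`, `μ ≠ ν`) at `x + e_κ` and at `x` differ by at most the COVARIANT
forward difference `‖V(x,κ)·V(∂p_{x+e_κ})·V(x,κ)⁻¹ − V(∂p_x)‖` plus the conjugation defect `2·(|x − y|₁·α)·α` — since
`v₀(x + e_κ) = V₀(x,κ)⁻¹·v₀(x)·V(x,κ)` and `|V₀(x,κ) − 1| ≤ |x − y|₁α` (`axial_bond_bound`, p. 25 l. 3). [folklore] -/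
theorem axial_plaq_step (V : B7Prop1Explicit.Site d → Fin d → 𝔸ˣ) (hV : ∀ x κ, V x κ ∈ U1 𝔸) (y : B7Prop1Explicit.Site d) {μ ν : Fin d}
    (hμν : μ ≠ ν) {α : ℝ} (hα : 0 ≤ α)
    (h44 : ∀ (x : B7Prop1Explicit.Site d) (κ κ' : Fin d), κ ≠ κ' → ‖((hol V x (plaqWord κ κ') : 𝔸ˣ) : 𝔸) - 1‖ ≤ α)
    (x : B7Prop1Explicit.Site d) (κ : Fin d) :
    ‖((hol (gaugeAct (axialFn V y) V) (x + e κ) (plaqWord μ ν) : 𝔸ˣ) : 𝔸)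
        - ((hol (gaugeAct (axialFn V y) V) x (plaqWord μ ν) : 𝔸ˣ) : 𝔸)‖
      ≤ ‖(V x κ : 𝔸) * ((hol V (x + e κ) (plaqWord μ ν) : 𝔸ˣ) : 𝔸) * (((V x κ)⁻¹ : 𝔸ˣ) : 𝔸)
          - ((hol V x (plaqWord μ ν) : 𝔸ˣ) : 𝔸)‖ + 2 * ((l1 (x - y) : ℝ) * α) * α := by
  set u : B7Prop1Explicit.Site d → 𝔸ˣ := axialFn V y with hu
  set V₀ : B7Prop1Explicit.Site d → Fin d → 𝔸ˣ := gaugeAct u V with hV₀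
  have huU : ∀ x, u x ∈ U1 𝔸 := fun x => axialFn_mem hV y x
  set P : 𝔸ˣ := hol V x (plaqWord μ ν) with hP
  set P' : 𝔸ˣ := hol V (x + e κ) (plaqWord μ ν) with hP'
  set hh : 𝔸ˣ := V₀ x κ with hhh
  have hu' : u (x + e κ) = hh⁻¹ * u x * V x κ := by
    have : hh = u x * V x κ * (u (x + e κ))⁻¹ := rfl
    rw [this]; group
  have e1 : hol V₀ (x + e κ) (plaqWord μ ν) = hh⁻¹ * (u x * (V x κ * P' * (V x κ)⁻¹) * (u x)⁻¹) * hh := by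
    rw [hV₀, hol_gaugeAct_closed _ _ _ _ (disp_plaqWord μ ν), hu', ← hP']; group
  have e0 : hol V₀ x (plaqWord μ ν) = u x * P * (u x)⁻¹ := by
    rw [hV₀, hol_gaugeAct_closed _ _ _ _ (disp_plaqWord μ ν)]
  have hb : ‖(hh : 𝔸) - 1‖ ≤ l1 (x - y) * α := axial_bond_bound V hV y h44 hα x κ
  have hhU : hh ∈ U1 𝔸 := gaugeAct_mem hV huU x κ
  set Q : 𝔸 := (u x : 𝔸) * ((V x κ : 𝔸) * (P' : 𝔸) * (((V x κ)⁻¹ : 𝔸ˣ) : 𝔸)) * (((u x)⁻¹ : 𝔸ˣ) : 𝔸) with hQ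
  have hQ1 : ‖Q - 1‖ ≤ α := by
    rw [hQ]
    refine (norm_units_conj_sub_one_le (huU x) _).trans ?_
    exact (norm_units_conj_sub_one_le (hV x κ) _).trans (h44 _ μ ν hμν)
  have e1' : ((hol V₀ (x + e κ) (plaqWord μ ν) : 𝔸ˣ) : 𝔸) = ((hh⁻¹ : 𝔸ˣ) : 𝔸) * Q * (hh : 𝔸) := by
    rw [e1, hQ]; simp only [Units.val_mul]
  have e0' : ((hol V₀ x (plaqWord μ ν) : 𝔸ˣ) : 𝔸) = (u x : 𝔸) * (P : 𝔸) * (((u x)⁻¹ : 𝔸ˣ) : 𝔸) := by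
    rw [e0]; simp only [Units.val_mul]
  rw [e1', e0']
  calc ‖((hh⁻¹ : 𝔸ˣ) : 𝔸) * Q * (hh : 𝔸) - (u x : 𝔸) * (P : 𝔸) * (((u x)⁻¹ : 𝔸ˣ) : 𝔸)‖
      = ‖(((hh⁻¹ : 𝔸ˣ) : 𝔸) * Q * (hh : 𝔸) - Q)
          + (u x : 𝔸) * ((V x κ : 𝔸) * (P' : 𝔸) * (((V x κ)⁻¹ : 𝔸ˣ) : 𝔸) - (P : 𝔸))
            * (((u x)⁻¹ : 𝔸ˣ) : 𝔸)‖ := by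
        rw [hQ]; congr 1; noncomm_ring
    _ ≤ ‖((hh⁻¹ : 𝔸ˣ) : 𝔸) * Q * (hh : 𝔸) - Q‖
          + ‖(u x : 𝔸) * ((V x κ : 𝔸) * (P' : 𝔸) * (((V x κ)⁻¹ : 𝔸ˣ) : 𝔸) - (P : 𝔸))
            * (((u x)⁻¹ : 𝔸ˣ) : 𝔸)‖ := norm_add_le _ _
    _ ≤ 2 * ‖(hh : 𝔸) - 1‖ * ‖Q - 1‖
          + ‖(V x κ : 𝔸) * (P' : 𝔸) * (((V x κ)⁻¹ : 𝔸ˣ) : 𝔸) - (P : 𝔸)‖ :=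
        add_le_add (norm_inv_conj_sub_self_le hhU Q) (B8CurlGradHolonomy.norm_conj_le _ _ (huU x).1 (huU x).2)
    _ ≤ 2 * ((l1 (x - y) : ℝ) * α) * α
          + ‖(V x κ : 𝔸) * (P' : 𝔸) * (((V x κ)⁻¹ : 𝔸ˣ) : 𝔸) - (P : 𝔸)‖ := by
        gcongr
    _ = _ := by rw [add_comm]

/-! ## §3 Along a lattice word: the telescoping sum -/

omit [NormedAlgebra ℂ 𝔸] [CompleteSpace 𝔸] in
/-- **ALONG A WORD.**  Under (44) with `α` and a POINTWISE COVARIANT ONE-STEP BOUND `γ` on the plaquette variables of the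
plane `μν` (`‖V(x,κ)V(∂p_{x+e_κ})V(x,κ)⁻¹ − V(∂p_x)‖ ≤ γ` for all `x, κ`), the axial-gauge plaquette variable changes by
at most `n·(γ + 2(R₁α)α)` along any word of length `n` from `x` with `|x − y|₁ + n ≤ R₁`. [folklore] -/
theorem axial_plaq_path (V : B7Prop1Explicit.Site d → Fin d → 𝔸ˣ) (hV : ∀ x κ, V x κ ∈ U1 𝔸) (y : B7Prop1Explicit.Site d) {μ ν : Fin d}
    (hμν : μ ≠ ν) {α : ℝ} (hα : 0 ≤ α)
    (h44 : ∀ (x : B7Prop1Explicit.Site d) (κ κ' : Fin d), κ ≠ κ' → ‖((hol V x (plaqWord κ κ') : 𝔸ˣ) : 𝔸) - 1‖ ≤ α)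
    {γ : ℝ} (hγ : ∀ (x : B7Prop1Explicit.Site d) (κ : Fin d),
      ‖(V x κ : 𝔸) * ((hol V (x + e κ) (plaqWord μ ν) : 𝔸ˣ) : 𝔸) * (((V x κ)⁻¹ : 𝔸ˣ) : 𝔸)
          - ((hol V x (plaqWord μ ν) : 𝔸ˣ) : 𝔸)‖ ≤ γ)
    (R₁ : ℕ) :
    ∀ (w : List (Letter d)) (x : B7Prop1Explicit.Site d), l1 (x - y) + w.length ≤ R₁ →
      ‖((hol (gaugeAct (axialFn V y) V) (x + disp w) (plaqWord μ ν) : 𝔸ˣ) : 𝔸)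
          - ((hol (gaugeAct (axialFn V y) V) x (plaqWord μ ν) : 𝔸ˣ) : 𝔸)‖
        ≤ w.length * (γ + 2 * ((R₁ : ℝ) * α) * α)
  | [], x, _ => by simp
  | l :: w, x, hx => by
    rw [List.length_cons] at hx
    have hγ0 : 0 ≤ γ := (norm_nonneg _).trans (hγ x μ)
    -- one step from `x` to `x + l.vec`
    have hstep : ‖((hol (gaugeAct (axialFn V y) V) (x + l.vec) (plaqWord μ ν) : 𝔸ˣ) : 𝔸)
        - ((hol (gaugeAct (axialFn V y) V) x (plaqWord μ ν) : 𝔸ˣ) : 𝔸)‖ ≤ γ + 2 * ((R₁ : ℝ) * α) * α := by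
      obtain ⟨κ, b⟩ := l
      cases b
      · -- backward letter: the forward step from `x - e κ`
        have hx' : (l1 (x - e κ - y) : ℝ) ≤ R₁ := by
          have := l1_add_le (x - y) (-e κ)
          rw [l1_neg, show x - y + -e κ = x - e κ - y by abel] at this
          have h1 : l1 (e κ : B7Prop1Explicit.Site d) = 1 := by simpa using l1_vec ((κ, true) : Letter d)
          rw [h1] at this
          exact_mod_cast (by omega : l1 (x - e κ - y) ≤ R₁)
        have h := axial_plaq_step V hV y hμν hα h44 (x - e κ) κ
        rw [sub_add_cancel] at h
        rw [Letter.vec_false, ← sub_eq_add_neg, norm_sub_rev]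
        refine h.trans ?_
        have h1 := hγ (x - e κ) κ
        rw [sub_add_cancel] at h1
        have h2 : (l1 (x - e κ - y) : ℝ) * α * α ≤ (R₁ : ℝ) * α * α :=
          mul_le_mul_of_nonneg_right (mul_le_mul_of_nonneg_right hx' hα) hα
        linarith
      · have hx' : (l1 (x - y) : ℝ) ≤ R₁ := by exact_mod_cast (by omega : l1 (x - y) ≤ R₁)
        rw [Letter.vec_true]
        refine (axial_plaq_step V hV y hμν hα h44 x κ).trans ?_
        have h1 := hγ x κ
        have h2 : (l1 (x - y) : ℝ) * α * α ≤ (R₁ : ℝ) * α * α :=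
          mul_le_mul_of_nonneg_right (mul_le_mul_of_nonneg_right hx' hα) hα
        linarith
    -- the rest of the word from `x + l.vec`
    have hx'' : l1 (x + l.vec - y) + w.length ≤ R₁ := by
      have := l1_add_le (x - y) l.vec
      rw [l1_vec, show x - y + l.vec = x + l.vec - y by abel] at this
      omega
    have ih := axial_plaq_path V hV y hμν hα h44 hγ R₁ w (x + l.vec) hx''
    rw [disp_cons, ← add_assoc, List.length_cons, Nat.cast_succ, add_mul, one_mul]
    calc _ = ‖(((hol (gaugeAct (axialFn V y) V) (x + l.vec + disp w) (plaqWord μ ν) : 𝔸ˣ) : 𝔸)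
              - ((hol (gaugeAct (axialFn V y) V) (x + l.vec) (plaqWord μ ν) : 𝔸ˣ) : 𝔸))
            + (((hol (gaugeAct (axialFn V y) V) (x + l.vec) (plaqWord μ ν) : 𝔸ˣ) : 𝔸)
              - ((hol (gaugeAct (axialFn V y) V) x (plaqWord μ ν) : 𝔸ˣ) : 𝔸))‖ := by
          rw [sub_add_sub_cancel]
      _ ≤ _ := norm_add_le _ _
      _ ≤ _ := add_le_add ih hstep

/-! ## §4 The oscillation over the averaging stencil -/

omit [NormedAlgebra ℂ 𝔸] [CompleteSpace 𝔸] in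
/-- **THE STENCIL OSCILLATION.**  For the coarse plaquette with corner `z` in the plane `μν` (`μ ≠ ν`), axial gauge at
`y = z + Le_μ + Le_ν`, and any two fine plaquettes `x = z + r + ie_μ + je_ν`, `x₀ = z + r₀ + i₀e_μ + j₀e_ν` of the
averaging stencil (`r, r₀ ∈ [0,L)^d`, `i, j, i₀, j₀ < L`): under (44) with `α` and the covariant one-step bound `γ`,
`‖V₀(∂p_x) − V₀(∂p_{x₀})‖ ≤ (2dL + 4L)·(γ + 2((3dL + 8L)α)α)` — §3 along the tree contour `Γ_{x₀,x}`
(`treeWord (x − x₀)`, length `|x − x₀|₁ ≤ 2dL + 4L`), every point of which is within `3dL + 8L` of `y`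
(crude `ℓ¹` bookkeeping). [folklore] -/
theorem axial_plaq_osc_stencil (L : ℕ) (z : B7Prop1Explicit.Site d) {μ ν : Fin d} (hμν : μ ≠ ν)
    (V : B7Prop1Explicit.Site d → Fin d → 𝔸ˣ) (hV : ∀ x κ, V x κ ∈ U1 𝔸) {α : ℝ} (hα : 0 ≤ α)
    (h44 : ∀ (x : B7Prop1Explicit.Site d) (κ κ' : Fin d), κ ≠ κ' → ‖((hol V x (plaqWord κ κ') : 𝔸ˣ) : 𝔸) - 1‖ ≤ α)
    {γ : ℝ} (hγ : ∀ (x : B7Prop1Explicit.Site d) (κ : Fin d),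
      ‖(V x κ : 𝔸) * ((hol V (x + e κ) (plaqWord μ ν) : 𝔸ˣ) : 𝔸) * (((V x κ)⁻¹ : 𝔸ˣ) : 𝔸)
          - ((hol V x (plaqWord μ ν) : 𝔸ˣ) : 𝔸)‖ ≤ γ)
    (r r₀ : Fin d → Fin L) {i j i₀ j₀ : ℕ} (hi : i < L) (hj : j < L) (hi₀ : i₀ < L) (hj₀ : j₀ < L) :
    ‖((hol (gaugeAct (axialFn V (z + (L : ℤ) • e μ + (L : ℤ) • e ν)) V)
          (z + boxVec L r + (i : ℤ) • e μ + (j : ℤ) • e ν) (plaqWord μ ν) : 𝔸ˣ) : 𝔸)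
      - ((hol (gaugeAct (axialFn V (z + (L : ℤ) • e μ + (L : ℤ) • e ν)) V)
          (z + boxVec L r₀ + (i₀ : ℤ) • e μ + (j₀ : ℤ) • e ν) (plaqWord μ ν) : 𝔸ˣ) : 𝔸)‖
      ≤ ((2 * (d * L) + 4 * L : ℕ) : ℝ) * (γ + 2 * (((3 * (d * L) + 8 * L : ℕ) : ℝ) * α) * α) := by
  have hγ0 : 0 ≤ γ := (norm_nonneg _).trans (hγ z μ)
  -- `ℓ¹` bookkeeping: the reference plaquette is within `dL + 4L` of `y` …
  have hx₀y : l1 (z + boxVec L r₀ + (i₀ : ℤ) • e μ + (j₀ : ℤ) • e ν - (z + (L : ℤ) • e μ + (L : ℤ) • e ν))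
      ≤ d * L + 4 * L := by
    rw [show z + boxVec L r₀ + (i₀ : ℤ) • e μ + (j₀ : ℤ) • e ν - (z + (L : ℤ) • e μ + (L : ℤ) • e ν)
      = boxVec L r₀ + (i₀ : ℤ) • e μ + (j₀ : ℤ) • e ν + -((L : ℤ) • e μ) + -((L : ℤ) • e ν) by abel]
    have h5 := l1_boxVec_le L r₀
    calc l1 (boxVec L r₀ + (i₀ : ℤ) • e μ + (j₀ : ℤ) • e ν + -((L : ℤ) • e μ) + -((L : ℤ) • e ν))
        ≤ l1 (boxVec L r₀ + (i₀ : ℤ) • e μ + (j₀ : ℤ) • e ν + -((L : ℤ) • e μ)) + l1 (-((L : ℤ) • e ν)) :=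
          l1_add_le _ _
      _ ≤ l1 (boxVec L r₀ + (i₀ : ℤ) • e μ + (j₀ : ℤ) • e ν) + l1 (-((L : ℤ) • e μ)) + l1 (-((L : ℤ) • e ν)) := by
          gcongr; exact l1_add_le _ _
      _ ≤ l1 (boxVec L r₀ + (i₀ : ℤ) • e μ) + l1 ((j₀ : ℤ) • e ν) + l1 (-((L : ℤ) • e μ))
          + l1 (-((L : ℤ) • e ν)) := by
          gcongr; exact l1_add_le _ _
      _ ≤ l1 (boxVec L r₀) + l1 ((i₀ : ℤ) • e μ) + l1 ((j₀ : ℤ) • e ν) + l1 (-((L : ℤ) • e μ))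
          + l1 (-((L : ℤ) • e ν)) := by
          gcongr; exact l1_add_le _ _
      _ ≤ d * L + 4 * L := by
          simp only [l1_neg, l1_zsmul_e, Int.natAbs_natCast]
          omega
  -- … and the two stencil plaquettes are within `2dL + 4L` of each other
  have hxx₀ : l1 ((z + boxVec L r + (i : ℤ) • e μ + (j : ℤ) • e ν)
      - (z + boxVec L r₀ + (i₀ : ℤ) • e μ + (j₀ : ℤ) • e ν)) ≤ 2 * (d * L) + 4 * L := by
    rw [show (z + boxVec L r + (i : ℤ) • e μ + (j : ℤ) • e ν) - (z + boxVec L r₀ + (i₀ : ℤ) • e μ + (j₀ : ℤ) • e ν)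
      = boxVec L r + -boxVec L r₀ + (i : ℤ) • e μ + -((i₀ : ℤ) • e μ) + (j : ℤ) • e ν + -((j₀ : ℤ) • e ν) by abel]
    have h5 := l1_boxVec_le L r
    have h6 := l1_boxVec_le L r₀
    calc l1 (boxVec L r + -boxVec L r₀ + (i : ℤ) • e μ + -((i₀ : ℤ) • e μ) + (j : ℤ) • e ν + -((j₀ : ℤ) • e ν))
        ≤ l1 (boxVec L r + -boxVec L r₀ + (i : ℤ) • e μ + -((i₀ : ℤ) • e μ) + (j : ℤ) • e ν)
          + l1 (-((j₀ : ℤ) • e ν)) := l1_add_le _ _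
      _ ≤ l1 (boxVec L r + -boxVec L r₀ + (i : ℤ) • e μ + -((i₀ : ℤ) • e μ)) + l1 ((j : ℤ) • e ν)
          + l1 (-((j₀ : ℤ) • e ν)) := by
          gcongr; exact l1_add_le _ _
      _ ≤ l1 (boxVec L r + -boxVec L r₀ + (i : ℤ) • e μ) + l1 (-((i₀ : ℤ) • e μ)) + l1 ((j : ℤ) • e ν)
          + l1 (-((j₀ : ℤ) • e ν)) := by
          gcongr; exact l1_add_le _ _
      _ ≤ l1 (boxVec L r + -boxVec L r₀) + l1 ((i : ℤ) • e μ) + l1 (-((i₀ : ℤ) • e μ)) + l1 ((j : ℤ) • e ν)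
          + l1 (-((j₀ : ℤ) • e ν)) := by
          gcongr; exact l1_add_le _ _
      _ ≤ l1 (boxVec L r) + l1 (-boxVec L r₀) + l1 ((i : ℤ) • e μ) + l1 (-((i₀ : ℤ) • e μ)) + l1 ((j : ℤ) • e ν)
          + l1 (-((j₀ : ℤ) • e ν)) := by
          gcongr; exact l1_add_le _ _
      _ ≤ 2 * (d * L) + 4 * L := by
          simp only [l1_neg, l1_zsmul_e, Int.natAbs_natCast]
          omega
  have hfit : l1 (z + boxVec L r₀ + (i₀ : ℤ) • e μ + (j₀ : ℤ) • e ν - (z + (L : ℤ) • e μ + (L : ℤ) • e ν))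
      + (treeWord ((z + boxVec L r + (i : ℤ) • e μ + (j : ℤ) • e ν)
          - (z + boxVec L r₀ + (i₀ : ℤ) • e μ + (j₀ : ℤ) • e ν))).length ≤ 3 * (d * L) + 8 * L := by
    rw [length_treeWord]; omega
  have h := axial_plaq_path V hV (z + (L : ℤ) • e μ + (L : ℤ) • e ν) hμν hα h44 hγ (3 * (d * L) + 8 * L)
    (treeWord ((z + boxVec L r + (i : ℤ) • e μ + (j : ℤ) • e ν)
      - (z + boxVec L r₀ + (i₀ : ℤ) • e μ + (j₀ : ℤ) • e ν)))
    (z + boxVec L r₀ + (i₀ : ℤ) • e μ + (j₀ : ℤ) • e ν) hfit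
  rw [disp_treeWord, add_sub_cancel, length_treeWord] at h
  refine h.trans (mul_le_mul_of_nonneg_right (by exact_mod_cast hxx₀) ?_)
  have : (0 : ℝ) ≤ ((3 * (d * L) + 8 * L : ℕ) : ℝ) * α := by positivity
  positivity

/-! ## §5 Proposition 1 two-sided from (44) and the covariant one-step bound alone -/

/-- **Proposition 1, TWO-SIDED, from a covariant one-step bound.**  Let `V` on `ℤ^d` take values in
`{|u| ≤ 1, |u⁻¹| ≤ 1}`, satisfy (44) with `α₀`, `512(d+1)(d+4)L²α₀ ≤ 1`, and the pointwise covariant one-step bound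
`‖V(x,κ)V(∂p_{x+e_κ})V(x,κ)⁻¹ − V(∂p_x)‖ ≤ γ` on the plaquettes of the plane `μν`.  Then for EVERY fine plaquette
`p₀ = (z + r₀ + i₀e_μ + j₀e_ν; μν)` of the averaging stencil of the coarse plaquette `p′` (corner `z`), with
`θ = 8(d+1)(d+4)L²α₀` and `ω = (2dL+4L)·(γ + 2((3dL+8L)α₀)α₀)`:
`L²·|V(∂p₀) − 1| ≤ |V̄(∂p′) − 1| + L²ω + 226θ²` and `|V̄(∂p′) − 1| ≤ L²·|V(∂p₀) − 1| + L²ω + 226θ²`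
(`N21AveragingLower.prop1_twoSided` with the oscillation supplied by §4).  NOT PRINTED. [folklore] -/
theorem prop1_twoSided_of_covariantStep (L : ℕ) (hL : 1 ≤ L) (z : B7Prop1Explicit.Site d) {μ ν : Fin d} (hμν : μ ≠ ν)
    (V : B7Prop1Explicit.Site d → Fin d → 𝔸ˣ) (hV : ∀ x κ, V x κ ∈ U1 𝔸) {α₀ : ℝ} (hα₀ : 0 ≤ α₀)
    (hsmall : 512 * (d + 1) * (d + 4) * (L : ℝ) ^ 2 * α₀ ≤ 1)
    (h44 : ∀ (x : B7Prop1Explicit.Site d) (κ κ' : Fin d), κ ≠ κ' → ‖((hol V x (plaqWord κ κ') : 𝔸ˣ) : 𝔸) - 1‖ ≤ α₀)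
    {γ : ℝ} (hγ : ∀ (x : B7Prop1Explicit.Site d) (κ : Fin d),
      ‖(V x κ : 𝔸) * ((hol V (x + e κ) (plaqWord μ ν) : 𝔸ˣ) : 𝔸) * (((V x κ)⁻¹ : 𝔸ˣ) : 𝔸)
          - ((hol V x (plaqWord μ ν) : 𝔸ˣ) : 𝔸)‖ ≤ γ)
    (r₀ : Fin d → Fin L) {i₀ j₀ : ℕ} (hi₀ : i₀ < L) (hj₀ : j₀ < L) :
    (L : ℝ) ^ 2 * ‖((hol V (z + boxVec L r₀ + (i₀ : ℤ) • e μ + (j₀ : ℤ) • e ν) (plaqWord μ ν) : 𝔸ˣ) : 𝔸) - 1‖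
        ≤ ‖((cplaq L (bavg L V) z μ ν : 𝔸ˣ) : 𝔸) - 1‖
          + ((L : ℝ) ^ 2 * (((2 * (d * L) + 4 * L : ℕ) : ℝ) * (γ + 2 * (((3 * (d * L) + 8 * L : ℕ) : ℝ) * α₀) * α₀))
            + 226 * (8 * (d + 1) * (d + 4) * (L : ℝ) ^ 2 * α₀) ^ 2) ∧
      ‖((cplaq L (bavg L V) z μ ν : 𝔸ˣ) : 𝔸) - 1‖
        ≤ (L : ℝ) ^ 2 * ‖((hol V (z + boxVec L r₀ + (i₀ : ℤ) • e μ + (j₀ : ℤ) • e ν) (plaqWord μ ν) : 𝔸ˣ) : 𝔸) - 1‖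
          + ((L : ℝ) ^ 2 * (((2 * (d * L) + 4 * L : ℕ) : ℝ) * (γ + 2 * (((3 * (d * L) + 8 * L : ℕ) : ℝ) * α₀) * α₀))
            + 226 * (8 * (d + 1) * (d + 4) * (L : ℝ) ^ 2 * α₀) ^ 2) :=
  prop1_twoSided L hL z hμν V hV hα₀ hsmall h44 (z + boxVec L r₀ + (i₀ : ℤ) • e μ + (j₀ : ℤ) • e ν)
    fun r _ _ hi hj => axial_plaq_osc_stencil L z hμν V hV hα₀ h44 hγ r r₀ hi hj hi₀ hj₀

/-- **Threshold form from the covariant one-step bound**: «coarse deviation `< t` ⇒ every stencil fine deviation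
`< (t + L²ω + 226θ²)∕L²`», `ω = (2dL+4L)·(γ + 2((3dL+8L)α₀)α₀)` (`N21AveragingLower.fine_lt_of_coarse_lt`). [folklore] -/
theorem fine_lt_of_coarse_lt_of_covariantStep (L : ℕ) (hL : 1 ≤ L) (z : B7Prop1Explicit.Site d) {μ ν : Fin d} (hμν : μ ≠ ν)
    (V : B7Prop1Explicit.Site d → Fin d → 𝔸ˣ) (hV : ∀ x κ, V x κ ∈ U1 𝔸) {α₀ : ℝ} (hα₀ : 0 ≤ α₀)
    (hsmall : 512 * (d + 1) * (d + 4) * (L : ℝ) ^ 2 * α₀ ≤ 1)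
    (h44 : ∀ (x : B7Prop1Explicit.Site d) (κ κ' : Fin d), κ ≠ κ' → ‖((hol V x (plaqWord κ κ') : 𝔸ˣ) : 𝔸) - 1‖ ≤ α₀)
    {γ : ℝ} (hγ : ∀ (x : B7Prop1Explicit.Site d) (κ : Fin d),
      ‖(V x κ : 𝔸) * ((hol V (x + e κ) (plaqWord μ ν) : 𝔸ˣ) : 𝔸) * (((V x κ)⁻¹ : 𝔸ˣ) : 𝔸)
          - ((hol V x (plaqWord μ ν) : 𝔸ˣ) : 𝔸)‖ ≤ γ)
    (r₀ : Fin d → Fin L) {i₀ j₀ : ℕ} (hi₀ : i₀ < L) (hj₀ : j₀ < L)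
    {t : ℝ} (ht : ‖((cplaq L (bavg L V) z μ ν : 𝔸ˣ) : 𝔸) - 1‖ < t) :
    ‖((hol V (z + boxVec L r₀ + (i₀ : ℤ) • e μ + (j₀ : ℤ) • e ν) (plaqWord μ ν) : 𝔸ˣ) : 𝔸) - 1‖
      < (t + ((L : ℝ) ^ 2 * (((2 * (d * L) + 4 * L : ℕ) : ℝ) * (γ + 2 * (((3 * (d * L) + 8 * L : ℕ) : ℝ) * α₀) * α₀))
          + 226 * (8 * (d + 1) * (d + 4) * (L : ℝ) ^ 2 * α₀) ^ 2)) / (L : ℝ) ^ 2 :=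
  fine_lt_of_coarse_lt L hL z hμν V hV hα₀ hsmall h44 (z + boxVec L r₀ + (i₀ : ℤ) • e μ + (j₀ : ℤ) • e ν)
    (fun r _ _ hi hj => axial_plaq_osc_stencil L z hμν V hV hα₀ h44 hγ r r₀ hi hj hi₀ hj₀) ht

end Summit.QuantumFields.YangMills.Theorems.N21AveragingOscillation

end
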